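import Literature.Geometry.Riemannian.RiemannianCoveringVolume
import HarnessLib

/-!
# Integration along a local isometry with finite constant fibres:
# `∫_{M₁} u ∘ F dV₁ = k ∫_{M₂} u dV₂`

Sequel to `RiemannianCoveringVolume.lean` (`Vol(M̃) = k · Vol(M)` for a `k`-sheeted local isometry
from a COMPACT manifold). Here the source may be non-compact and the identity is weighted: for a
`C^∞` local isometry `F : M₁ → M₂` (a local diffeomorphism with `g₂(dF v, dF w) = g₁(v, w)`)
between Riemannian manifolds of the same dimension, `M₁` second countable, all of whose fibres
have exactly `k` points, and every measurable `u ≥ 0` on `M₂`,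

  `∫⁻_{M₁} u (F x) dV_{g₁} = k · ∫⁻_{M₂} u dV_{g₂}`     (`lintegral_comp_eq_mul_of_card_fibre`).

This is the area formula for the Riemannian measures (Federer 1969, §3.2.3 / §3.2.46, with
Jacobian `1` and multiplicity `k`; Chavel 2006, §IV.1 and Exercise IV.18 for Riemannian coverings;
Lee 2018, Problem 2-14), proved from the tree's local statement
`RiemannianCovering.riemannianMeasure_image_eq_of_subset` (a map which preserves the distance on
`U` preserves the measure of subsets of `U`) by a countable measurable partition `(A_i)` of `M₁`
subordinate to the distance-preserving injectivity neighbourhoods of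
`RiemannianCovering.exists_nhds_edist_comp_eq`:
`∫ u∘F = Σ_i ∫_{A_i} u∘F = Σ_i ∫_{F(A_i)} u = ∫ u · #{i | y ∈ F(A_i)} = k ∫ u`, the last step
because `x ↦ (the i with x ∈ A_i)` is a bijection from the fibre of `y` onto `{i | y ∈ F(A_i)}`.

* `measurableSet_image_of_injOn` — images of measurable subsets of an injectivity domain of a
  continuous open map are measurable (open embedding);
* `map_restrict_eq_restrict_image` — `F_*(V₁⌊A) = V₂⌊F(A)` for `A` inside a distance-preserving
  injectivity neighbourhood;
* `lintegral_comp_eq_mul_of_card_fibre` — the theorem.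

First use: the weighted volume `∫ e^{-f} dV` of quotients of the shrinking cylinder in the
classification of three-dimensional gradient shrinking Ricci solitons
(`ThreeShrinkerClassification.lean`, disjuncts (b), (c)). Everything is proved; no definitions, no
named facts (D-0026).

## References

* H. Federer, *Geometric Measure Theory* (1969), §2.10.11, §3.2.3, §3.2.46. [Federer1969]
* I. Chavel, *Riemannian Geometry: A Modern Introduction*, 2nd ed. (2006), §IV.1,
  Exercise IV.18. [Chavel2006]
* J. M. Lee, *Introduction to Riemannian Manifolds*, 2nd ed. (2018), Problem 2-14. [Lee2018]
-/

noncomputable section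

open Bundle Set Function Filter MeasureTheory Manifold Module Topology
open scoped Manifold ContDiff Topology ENNReal NNReal

namespace Literature.Geometry.Riemannian

open Lorentzian Lorentzian.PseudoRiemannianMetric

namespace RiemannianCovering

variable {E₁ : Type*} [NormedAddCommGroup E₁] [NormedSpace ℝ E₁] [FiniteDimensional ℝ E₁]
  {H₁ : Type*} [TopologicalSpace H₁] {I₁ : ModelWithCorners ℝ E₁ H₁}
  {M₁ : Type*} [TopologicalSpace M₁] [ChartedSpace H₁ M₁] [IsManifold I₁ ∞ M₁]
  {E₂ : Type*} [NormedAddCommGroup E₂] [NormedSpace ℝ E₂] [FiniteDimensional ℝ E₂]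
  {H₂ : Type*} [TopologicalSpace H₂] {I₂ : ModelWithCorners ℝ E₂ H₂}
  {M₂ : Type*} [TopologicalSpace M₂] [ChartedSpace H₂ M₂] [IsManifold I₂ ∞ M₂]
  {g₁ : PseudoRiemannianMetric I₁ ∞ E₁ (TangentSpace I₁ : M₁ → Type _)}
  {g₂ : PseudoRiemannianMetric I₂ ∞ E₂ (TangentSpace I₂ : M₂ → Type _)}
  {F : M₁ → M₂}

variable [T3Space M₁] [MeasurableSpace M₁] [BorelSpace M₁] [T3Space M₂] [MeasurableSpace M₂]
  [BorelSpace M₂]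

/-! ### Measurability of images and the push-forward of the restricted measure -/

omit [IsManifold I₁ ∞ M₁] [IsManifold I₂ ∞ M₂] [FiniteDimensional ℝ E₁] [FiniteDimensional ℝ E₂]
  [T3Space M₁] [T3Space M₂] in
/-- **Images of measurable subsets of an injectivity domain are measurable**: if `F` is continuous
and open, `U` is open and `F` is injective on `U`, then `F(A)` is measurable for every measurable
`A ⊆ U` (the restriction of `F` to `U` is an open embedding). [folklore] -/
theorem measurableSet_image_of_injOn (hcont : Continuous F) (hopen : IsOpenMap F) {U : Set M₁}
    (hU : IsOpen U) (hinj : InjOn F U) {A : Set M₁} (hA : MeasurableSet A) (hAU : A ⊆ U) :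
    MeasurableSet (F '' A) := by
  have hemb : IsOpenEmbedding (U.restrict F) :=
    IsOpenEmbedding.of_continuous_injective_isOpenMap (hcont.comp continuous_subtype_val)
      hinj.injective (hopen.comp hU.isOpenMap_subtype_val)
  have himage : F '' A = (U.restrict F) '' ((↑) ⁻¹' A : Set U) := by
    rw [restrict_eq, image_comp, Subtype.image_preimage_coe, inter_eq_right.2 hAU]
  rw [himage]
  exact hemb.measurableEmbedding.measurableSet_image.2 (measurable_subtype_coe hA)

/-- **`F_*(V₁⌊A) = V₂⌊F(A)`** for `A` inside a set `U` on which `F` preserves the Riemannian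
distance (`d₂(F x, F y) = d₁(x, y)`, hence `F` is injective on `U`) and `dim M₁ = dim M₂`: for
measurable `C ⊆ M₂`, `V₁(A ∩ F⁻¹ C) = V₂(F(A ∩ F⁻¹ C)) = V₂(F(A) ∩ C)`
(`riemannianMeasure_image_eq_of_subset`). [cite: Federer1969, §2.10.11 and §3.2.46] -/
theorem map_restrict_eq_restrict_image (hg₁ : g₁.IsRiemannian) (hg₂ : g₂.IsRiemannian)
    (hmeas : Measurable F) {U A : Set M₁}
    (hU : ∀ x ∈ U, ∀ y ∈ U, g₂.edist hg₂ (F x) (F y) = g₁.edist hg₁ x y) (hAU : A ⊆ U)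
    (hdim : finrank ℝ E₁ = finrank ℝ E₂) :
    Measure.map F ((riemannianMeasure (g₁.toContMDiffRiemannianMetric hg₁)).restrict A) =
      (riemannianMeasure (g₂.toContMDiffRiemannianMetric hg₂)).restrict (F '' A) := by
  ext C hC
  rw [Measure.map_apply hmeas hC, Measure.restrict_apply (hmeas hC), Measure.restrict_apply hC,
    inter_comm (F ⁻¹' C) A, inter_comm C (F '' A), ← image_inter_preimage F A C]
  exact (riemannianMeasure_image_eq_of_subset hg₁ hg₂ hU (inter_subset_left.trans hAU) hdim).symm

/-! ### The theorem -/

/-- **Integration along a local isometry with `k`-point fibres**: for a `C^∞` local isometry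
`F : M₁ → M₂` (local diffeomorphism with `g₂(dF v, dF w) = g₁(v, w)`) between Riemannian manifolds
of the same dimension, `M₁` second countable, all of whose fibres have exactly `k` points, and
every measurable `u : M₂ → [0, ∞]`,
`∫⁻ u (F x) dV_{g₁} = k · ∫⁻ u dV_{g₂}` (area formula with multiplicity `k`; for `u = 1` and `M₁`
compact this is `riemannianMeasure_univ_eq_mul_of_card_fibre`).
[cite: Federer1969, §3.2.3 and §3.2.46] [cite: Chavel2006, §IV.1, Exercise IV.18]
[cite: Lee2018, Problem 2-14] -/
theorem lintegral_comp_eq_mul_of_card_fibre [SecondCountableTopology M₁]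
    (hg₁ : g₁.IsRiemannian) (hg₂ : g₂.IsRiemannian) (hF : ContMDiff I₁ I₂ ∞ F)
    (hloc : IsLocalDiffeomorph I₁ I₂ ∞ F)
    (hiso : ∀ (x : M₁) (v w : TangentSpace I₁ x),
      g₂.val (F x) (mfderiv I₁ I₂ F x v) (mfderiv I₁ I₂ F x w) = g₁.val x v w)
    (hdim : finrank ℝ E₁ = finrank ℝ E₂) {k : ℕ}
    (hfib : ∀ y : M₂, ∃ s : Finset M₁, s.card = k ∧ ∀ x, x ∈ s ↔ F x = y)
    {u : M₂ → ℝ≥0∞} (hu : Measurable u) :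
    ∫⁻ x, u (F x) ∂(riemannianMeasure (g₁.toContMDiffRiemannianMetric hg₁)) =
      k * ∫⁻ y, u y ∂(riemannianMeasure (g₂.toContMDiffRiemannianMetric hg₂)) := by
  classical
  set μ₁ := riemannianMeasure (g₁.toContMDiffRiemannianMetric hg₁) with hμ₁
  set μ₂ := riemannianMeasure (g₂.toContMDiffRiemannianMetric hg₂) with hμ₂
  have hcont : Continuous F := hF.continuous
  have hmeasF : Measurable F := hcont.measurable
  have hopen : IsOpenMap F := hloc.isLocalHomeomorph.isOpenMap
  have hF1 : ContMDiff I₁ I₂ 1 F := hF.of_le (by exact_mod_cast (le_top : (1 : ℕ∞) ≤ ⊤))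
  -- the empty case
  rcases isEmpty_or_nonempty M₁ with hE | hne
  · have h1 : ∫⁻ x, u (F x) ∂μ₁ = 0 := by
      rw [Measure.eq_zero_of_isEmpty μ₁, lintegral_zero_measure]
    rw [h1]
    rcases Nat.eq_zero_or_pos k with hk | hk
    · rw [hk, Nat.cast_zero, zero_mul]
    · have hM₂ : IsEmpty M₂ := ⟨fun y ↦ by
        obtain ⟨s, hs, -⟩ := hfib y
        obtain ⟨x, -⟩ := Finset.card_pos.1 (hs ▸ hk)
        exact hE.elim x⟩
      rw [Measure.eq_zero_of_isEmpty μ₂, lintegral_zero_measure, mul_zero]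
  -- distance-preserving injectivity neighbourhoods and a countable subcover
  choose U hUo hxU hinj hUiso using fun x : M₁ ↦
    exists_nhds_edist_comp_eq hg₁ hg₂ hF1 hiso (hloc x)
  obtain ⟨T, hTc, hTU⟩ := TopologicalSpace.countable_cover_nhds fun x ↦ (hUo x).mem_nhds (hxU x)
  have hTne : T.Nonempty := by
    by_contra h
    rw [not_nonempty_iff_eq_empty] at h
    have := hTU
    rw [h, biUnion_empty] at this
    exact (univ_eq_empty_iff.1 this.symm).elim hne.some
  obtain ⟨c, hc⟩ := hTc.exists_eq_range hTne
  have hcover : ∀ x : M₁, ∃ i : ℕ, x ∈ U (c i) := fun x ↦ by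
    have hx : x ∈ ⋃ a ∈ T, U a := hTU ▸ mem_univ x
    obtain ⟨a, ha, hxa⟩ := mem_iUnion₂.1 hx
    rw [hc] at ha
    obtain ⟨i, rfl⟩ := ha
    exact ⟨i, hxa⟩
  -- the measurable partition subordinate to `(U (c i))`
  set A : ℕ → Set M₁ := disjointed fun i ↦ U (c i) with hA
  have hAU : ∀ i, A i ⊆ U (c i) := fun i ↦ disjointed_subset _ i
  have hAm : ∀ i, MeasurableSet (A i) := MeasurableSet.disjointed fun i ↦ (hUo (c i)).measurableSet
  have hAd : Pairwise (Disjoint on A) := disjoint_disjointed _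
  have hAcov : ∀ x : M₁, ∃ i, x ∈ A i := fun x ↦ by
    have hx : x ∈ ⋃ i, U (c i) := mem_iUnion.2 (hcover x)
    rw [← iUnion_disjointed] at hx
    exact mem_iUnion.1 hx
  have hAuniv : (⋃ i, A i) = univ := eq_univ_of_forall fun x ↦ mem_iUnion.2 (hAcov x)
  have hFAm : ∀ i, MeasurableSet (F '' A i) := fun i ↦
    measurableSet_image_of_injOn hcont hopen (hUo (c i)) (hinj (c i)) (hAm i) (hAU i)
  -- the index of a point and the multiplicity count
  have hidx : ∀ x i, x ∈ A i → ∀ j, x ∈ A j → i = j := fun x i hi j hj ↦ by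
    by_contra hij
    exact (Set.disjoint_left.1 (hAd hij) hi) hj
  have hcount : ∀ y : M₂,
      (∑' i, (F '' A i).indicator (fun _ ↦ (1 : ℝ≥0∞)) y) = k := by
    intro y
    obtain ⟨s, hscard, hs⟩ := hfib y
    choose idx hidxA using hAcov
    have hiff : ∀ i, y ∈ F '' A i ↔ i ∈ s.image idx := by
      intro i
      constructor
      · rintro ⟨x, hxA, rfl⟩
        exact Finset.mem_image.2 ⟨x, (hs x).2 rfl, (hidx x _ (hidxA x) _ hxA)⟩
      · intro hi
        obtain ⟨x, hxs, rfl⟩ := Finset.mem_image.1 hi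
        exact ⟨x, hidxA x, (hs x).1 hxs⟩
    have hinjidx : Set.InjOn idx s := by
      intro x hx x' hx' hxx'
      have hxA : x ∈ A (idx x) := hidxA x
      have hx'A : x' ∈ A (idx x) := hxx' ▸ hidxA x'
      exact hinj (c (idx x)) (hAU _ hxA) (hAU _ hx'A) (((hs x).1 hx).trans ((hs x').1 hx').symm)
    rw [tsum_eq_sum (s := s.image idx) (fun i hi ↦ by
      rw [indicator_of_notMem ((hiff i).not.2 hi)])]
    rw [Finset.sum_congr rfl (fun i hi ↦ indicator_of_mem ((hiff i).2 hi) _), Finset.sum_const,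
      nsmul_eq_mul, mul_one, Finset.card_image_of_injOn hinjidx, hscard]
  -- assemble
  calc ∫⁻ x, u (F x) ∂μ₁ = ∫⁻ x in ⋃ i, A i, u (F x) ∂μ₁ := by rw [hAuniv, Measure.restrict_univ]
    _ = ∑' i, ∫⁻ x in A i, u (F x) ∂μ₁ := lintegral_iUnion hAm hAd _
    _ = ∑' i, ∫⁻ y in F '' A i, u y ∂μ₂ := by
        refine tsum_congr fun i ↦ ?_
        rw [← map_restrict_eq_restrict_image hg₁ hg₂ hmeasF (hUiso (c i)) (hAU i) hdim,
          lintegral_map hu hmeasF]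
    _ = ∑' i, ∫⁻ y, (F '' A i).indicator u y ∂μ₂ := by
        refine tsum_congr fun i ↦ ?_
        rw [lintegral_indicator (hFAm i)]
    _ = ∫⁻ y, ∑' i, (F '' A i).indicator u y ∂μ₂ :=
        (lintegral_tsum fun i ↦ (hu.indicator (hFAm i)).aemeasurable).symm
    _ = ∫⁻ y, u y * k ∂μ₂ := by
        refine lintegral_congr fun y ↦ ?_
        have h : ∀ i, (F '' A i).indicator u y =
            u y * (F '' A i).indicator (fun _ ↦ (1 : ℝ≥0∞)) y := fun i ↦ by
          by_cases hy : y ∈ F '' A i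
          · rw [indicator_of_mem hy, indicator_of_mem hy, mul_one]
          · rw [indicator_of_notMem hy, indicator_of_notMem hy, mul_zero]
        simp_rw [h]
        rw [ENNReal.tsum_mul_left, hcount y]
    _ = k * ∫⁻ y, u y ∂μ₂ := by
        rw [lintegral_mul_const _ hu, mul_comm]

end RiemannianCovering

end Literature.Geometry.Riemannian

end
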